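import Literature.NumberTheory.Automorphic.RestrictedTensorCoinvariantBound
import Literature.NumberTheory.Automorphic.RestrictedTensorProductProofs
import Mathlib.LinearAlgebra.Basis.VectorSpace
import HarnessLib

/-!
# Uniqueness of functionals on a restricted tensor product killing one-dimensional local
# coinvariant kernels (the algebra of `dim Hom_N(⊗'_v π_v, ψ) ≤ 1` from `dim Hom_{N_v}(π_v, ψ_v) ≤ 1`)

Pure linear algebra behind the deduction of the uniqueness of global Whittaker functionals from the
local one (Cogdell (2004), §1.2, proof of Cor. 1.4: "`Λ = ⊗_v Λ_v` … by the local uniqueness";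
Bump (1997), Thm. 3.5.2; Shalika (1974), §4; Flath (1979), §2): let `(W, j)` be a restricted tensor
product `⊗'_i (V i, x₀ i)` (`IsRestrictedTensorProduct`), and for each `i` let `N i ≤ V i` be a
submodule with `V i = k e_i + N i` for some `e_i` (i.e. `dim (V i ⧸ N i) ≤ 1` — for Whittaker
functionals, `N i` is the span of the `ρ_i(u) v - ψ_i(u) v` and this is local uniqueness,
`exists_generator_of_functionals_unique`). Then any two linear functionals on `W` which vanish on
every slot image `j (x.update i n)`, `n ∈ N i`, are proportional as soon as one of them is non-zero
(`exists_eq_smul_of_forall_apply_update_eq_zero`).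

Proof: on each finite stage `W_S = span {j (extend S m)}` the restrictions factor through a quotient
of rank `≤ 1` (the tree's slot-by-slot bound `rank_quotient_le_one_of_span_range_eq_top`, applied over
the finite index type `↥S`), hence are proportional there; the stages exhaust `W`
(`IsRestrictedTensorProduct.exists_mem_range_liftFinset`) and are directed, so the constant of
proportionality, read off at one vector where the first functional is non-zero, is the same on all
stages. No named fact.

## References

* J. W. Cogdell, *Lectures on L-functions, converse theorems, and functoriality for GL_n*, Fields
  Inst. Monogr. 20 (2004), §1.2.
* D. Bump, *Automorphic forms and representations* (1997), Thm. 3.5.2.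
* D. Flath, *Decomposition of representations into tensor products*, Corvallis 1979, §2.
-/

open scoped RestrictedProduct TensorProduct
open Filter

namespace Literature.NumberTheory.Automorphic

universe u v w

/-! ### 1. Generators of rank-`≤ 1` quotients from uniqueness of functionals -/

section Generator

variable {k : Type*} [Field k] {V : Type*} [AddCommGroup V] [Module k V]

/-- **`dim (V ⧸ N) ≤ 1` in generator form from "functionals vanishing on `N` are unique up to
scalars"**: if any two linear functionals on `V` killing `N`, the first non-zero, are proportional,
then `V = k e + N` for some `e`. (Two independent vectors of `V ⧸ N` would carry two non-proportional
coordinate functionals.) [folklore] -/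
theorem exists_generator_of_functionals_unique (N : Submodule k V)
    (h : ∀ μ₁ μ₂ : V →ₗ[k] k, (∀ x ∈ N, μ₁ x = 0) → (∀ x ∈ N, μ₂ x = 0) → μ₁ ≠ 0 →
      ∃ c : k, μ₂ = c • μ₁) :
    ∃ e : V, ∀ v : V, ∃ r : k, v - r • e ∈ N := by
  classical
  by_cases hall : ∀ q : V ⧸ N, q = 0
  · refine ⟨0, fun v => ⟨0, ?_⟩⟩
    rw [zero_smul, sub_zero]
    exact (Submodule.Quotient.mk_eq_zero N).1 (hall _)
  push Not at hall
  obtain ⟨q₀, hq₀⟩ := hall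
  -- `V ⧸ N = k q₀`
  have hspan : ∀ q : V ⧸ N, ∃ r : k, r • q₀ = q := by
    by_contra hnot
    push Not at hnot
    obtain ⟨q₁, hq₁⟩ := hnot
    -- `q₀, q₁` are linearly independent
    have hli : LinearIndependent k ![q₀, q₁] := by
      refine LinearIndependent.pair_iff.2 fun s t hst => ?_
      by_cases ht : t = 0
      · subst ht
        rw [zero_smul, add_zero, smul_eq_zero] at hst
        exact ⟨hst.resolve_right hq₀, rfl⟩
      · exfalso
        refine hq₁ (-(t⁻¹ * s)) ?_
        have h1 : t • q₁ = -(s • q₀) := eq_neg_of_add_eq_zero_right hst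
        calc -(t⁻¹ * s) • q₀ = t⁻¹ • (-(s • q₀)) := by rw [neg_smul, mul_smul, smul_neg]
          _ = t⁻¹ • (t • q₁) := by rw [h1]
          _ = q₁ := by rw [smul_smul, inv_mul_cancel₀ ht, one_smul]
    -- coordinate functionals of a basis extending `{q₀, q₁}`
    let b := Module.Basis.extend hli.linearIndepOn_id
    have hmem : ∀ l : Fin 2, ![q₀, q₁] l ∈ Set.range ![q₀, q₁] := fun l => ⟨l, rfl⟩
    have hsub : Set.range ![q₀, q₁] ⊆ hli.linearIndepOn_id.extend (Set.subset_univ _) :=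
      hli.linearIndepOn_id.subset_extend _
    let i₀ : hli.linearIndepOn_id.extend (Set.subset_univ _) := ⟨q₀, hsub (hmem 0)⟩
    let i₁ : hli.linearIndepOn_id.extend (Set.subset_univ _) := ⟨q₁, hsub (hmem 1)⟩
    have hb₀ : b i₀ = q₀ := Module.Basis.extend_apply_self _ _
    have hb₁ : b i₁ = q₁ := Module.Basis.extend_apply_self _ _
    have hi : i₀ ≠ i₁ := by
      intro h01
      have : q₀ = q₁ := congrArg Subtype.val h01
      exact hq₁ 1 (by rw [one_smul, this])
    let μ₁ : V →ₗ[k] k := (b.coord i₀).comp N.mkQ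
    let μ₂ : V →ₗ[k] k := (b.coord i₁).comp N.mkQ
    have hkill : ∀ (l : hli.linearIndepOn_id.extend (Set.subset_univ _)) (x : V), x ∈ N →
        ((b.coord l).comp N.mkQ) x = 0 := fun l x hx => by
      rw [LinearMap.comp_apply, Submodule.mkQ_apply, (Submodule.Quotient.mk_eq_zero N).2 hx, map_zero]
    obtain ⟨v₀, hv₀⟩ := Submodule.mkQ_surjective N q₀
    obtain ⟨v₁, hv₁⟩ := Submodule.mkQ_surjective N q₁
    have hrepr₀ : b.repr q₀ = Finsupp.single i₀ 1 := by
      have h0 := b.repr_self i₀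
      rwa [hb₀] at h0
    have hrepr₁ : b.repr q₁ = Finsupp.single i₁ 1 := by
      have h0 := b.repr_self i₁
      rwa [hb₁] at h0
    have hμ₁v₀ : μ₁ v₀ = 1 := by
      change b.coord i₀ (N.mkQ v₀) = 1
      rw [hv₀, Module.Basis.coord_apply, hrepr₀, Finsupp.single_eq_same]
    have hμ₂v₀ : μ₂ v₀ = 0 := by
      change b.coord i₁ (N.mkQ v₀) = 0
      rw [hv₀, Module.Basis.coord_apply, hrepr₀, Finsupp.single_eq_of_ne hi.symm]
    have hμ₂v₁ : μ₂ v₁ = 1 := by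
      change b.coord i₁ (N.mkQ v₁) = 1
      rw [hv₁, Module.Basis.coord_apply, hrepr₁, Finsupp.single_eq_same]
    have hne : μ₁ ≠ 0 := fun h0 => by
      rw [h0, LinearMap.zero_apply] at hμ₁v₀
      exact zero_ne_one hμ₁v₀
    obtain ⟨c, hc⟩ := h μ₁ μ₂ (hkill i₀) (hkill i₁) hne
    have h2 : μ₂ v₀ = c * μ₁ v₀ := by rw [hc, LinearMap.smul_apply, smul_eq_mul]
    rw [hμ₂v₀, hμ₁v₀, mul_one] at h2
    have h3 : μ₂ v₁ = c * μ₁ v₁ := by rw [hc, LinearMap.smul_apply, smul_eq_mul]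
    rw [hμ₂v₁, ← h2, zero_mul] at h3
    exact one_ne_zero h3
  obtain ⟨e, he⟩ := Submodule.mkQ_surjective N q₀
  refine ⟨e, fun v => ?_⟩
  obtain ⟨r, hr⟩ := hspan (N.mkQ v)
  refine ⟨r, (Submodule.Quotient.eq N).1 ?_⟩
  change N.mkQ v = N.mkQ (r • e)
  rw [map_smul, he, hr]

/-- **Functionals on a module of rank `≤ 1` are proportional.** [folklore] -/
theorem dual_eq_smul_of_rank_le_one {Q : Type*} [AddCommGroup Q] [Module k Q]
    (hQ : Module.rank k Q ≤ 1) (μ₁ μ₂ : Q →ₗ[k] k) (hne : μ₁ ≠ 0) : ∃ c : k, μ₂ = c • μ₁ := by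
  obtain ⟨q₀, hq₀⟩ := rank_le_one_iff.1 hQ
  have h1 : μ₁ q₀ ≠ 0 := by
    intro h0
    apply hne
    refine LinearMap.ext fun q => ?_
    obtain ⟨r, rfl⟩ := hq₀ q
    rw [map_smul, h0, smul_zero, LinearMap.zero_apply]
  refine ⟨μ₂ q₀ * (μ₁ q₀)⁻¹, LinearMap.ext fun q => ?_⟩
  obtain ⟨r, rfl⟩ := hq₀ q
  rw [LinearMap.smul_apply, map_smul, map_smul, smul_eq_mul, smul_eq_mul, smul_eq_mul]
  field_simp

end Generator

/-! ### 2. The finite stages `W_S = span {j (extend S m)}` -/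

section Stage

variable {ι : Type u} [DecidableEq ι] {k : Type*} [Field k] {V : ι → Type v} [∀ i, AddCommGroup (V i)]
  [∀ i, Module k (V i)] {x₀ : ∀ i, V i} {W : Type w} [AddCommGroup W] [Module k W]

/-- **The stage map**: `j` on the families supported on the finset `S` (base vectors off `S`), as a
map on the restricted families over the finite index type `↥S`. [folklore] -/
def stageMap (j : RestrictedFamily V x₀ → W) (S : Finset ι) :
    RestrictedFamily (fun i : S => V i) (fun i : S => x₀ i) → W :=
  fun m => j (RestrictedFamily.extend S ⇑m)

omit [∀ i, AddCommGroup (V i)] [AddCommGroup W] in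
/-- Unfolding of `stageMap`. [folklore] -/
theorem stageMap_apply (j : RestrictedFamily V x₀ → W) (S : Finset ι)
    (m : RestrictedFamily (fun i : S => V i) (fun i : S => x₀ i)) :
    stageMap j S m = j (RestrictedFamily.extend S ⇑m) := rfl

omit [∀ i, AddCommGroup (V i)] [AddCommGroup W] in
/-- The values of the stage map are the values `j (extend S m)` over all finite families `m`. [folklore] -/
theorem range_stageMap (j : RestrictedFamily V x₀ → W) (S : Finset ι) :
    Set.range (stageMap j S) = Set.range fun m : (∀ i : S, V i) => j (RestrictedFamily.extend S m) := by
  refine Set.Subset.antisymm ?_ ?_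
  · rintro _ ⟨m, rfl⟩
    exact ⟨⇑m, rfl⟩
  · rintro _ ⟨m, rfl⟩
    exact ⟨RestrictedFamily.ofFun m, rfl⟩

variable (k) in
/-- **The stage `W_S`**: the span of the values `j (extend S m)`. [folklore] -/
def stage (j : RestrictedFamily V x₀ → W) (S : Finset ι) : Submodule k W :=
  Submodule.span k (Set.range (stageMap j S))

/-- The stage `W_S` is the range of `liftFinset S`. [folklore] -/
theorem stage_eq_range_liftFinset {j : RestrictedFamily V x₀ → W} (hj : IsRestrictedMultilinear k j)
    (S : Finset ι) : stage k j S = LinearMap.range (hj.liftFinset S) := by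
  rw [stage, range_stageMap, hj.range_liftFinset S]

/-- The stage map is restricted-multilinear. [folklore] -/
theorem isRestrictedMultilinear_stageMap {j : RestrictedFamily V x₀ → W} (hj : IsRestrictedMultilinear k j)
    (S : Finset ι) : IsRestrictedMultilinear k (stageMap j S) where
  map_update_add m i v w := by
    simp only [stageMap_apply, RestrictedFamily.coe_update, RestrictedFamily.extend_update]
    exact hj.map_update_add _ _ _ _
  map_update_smul m i c v := by
    simp only [stageMap_apply, RestrictedFamily.coe_update, RestrictedFamily.extend_update]
    exact hj.map_update_smul _ _ _ _

/-- The stage map corestricted to the stage. [folklore] -/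
def stageMap' (j : RestrictedFamily V x₀ → W) (S : Finset ι) :
    RestrictedFamily (fun i : S => V i) (fun i : S => x₀ i) → stage k j S :=
  fun m => ⟨stageMap j S m, Submodule.subset_span ⟨m, rfl⟩⟩

/-- The corestricted stage map is restricted-multilinear. [folklore] -/
theorem isRestrictedMultilinear_stageMap' {j : RestrictedFamily V x₀ → W} (hj : IsRestrictedMultilinear k j)
    (S : Finset ι) : IsRestrictedMultilinear k (stageMap' (k := k) j S) :=
  ⟨fun m i v w => Subtype.ext ((isRestrictedMultilinear_stageMap hj S).map_update_add m i v w),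
    fun m i c v => Subtype.ext ((isRestrictedMultilinear_stageMap hj S).map_update_smul m i c v)⟩

omit [∀ i, AddCommGroup (V i)] [∀ i, Module k (V i)] in
/-- The values of the corestricted stage map span the stage. [folklore] -/
theorem span_range_stageMap' (j : RestrictedFamily V x₀ → W) (S : Finset ι) :
    Submodule.span k (Set.range (stageMap' (k := k) j S)) = ⊤ := by
  have hset : Set.range (stageMap' (k := k) j S) =
      ((↑) : stage k j S → W) ⁻¹' Set.range (stageMap j S) := by
    refine Set.ext fun w => ⟨?_, ?_⟩
    · rintro ⟨m, rfl⟩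
      exact ⟨m, rfl⟩
    · rintro ⟨m, hm⟩
      exact ⟨m, Subtype.ext hm⟩
  rw [hset]
  exact Submodule.span_span_coe_preimage

/-- **Proportionality on a stage**: for submodules `N i ≤ V i` with `V i = k e_i + N i`, two
functionals on `W` vanishing on all slot images `j (x.update i n)`, `n ∈ N i`, are proportional on
the stage `W_S` as soon as the first is non-zero somewhere on it (the stage modulo the slot images
of the `N i` has rank `≤ 1`, `rank_quotient_le_one_of_span_range_eq_top`). [folklore] -/
theorem exists_forall_mem_stage_eq_mul {j : RestrictedFamily V x₀ → W} (hj : IsRestrictedMultilinear k j)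
    (N : ∀ i, Submodule k (V i)) (he : ∀ i, ∃ e : V i, ∀ v : V i, ∃ r : k, v - r • e ∈ N i)
    (S : Finset ι) {Λ₁ Λ₂ : W →ₗ[k] k}
    (hΛ₁ : ∀ (x : RestrictedFamily V x₀) (i : ι), ∀ n ∈ N i, Λ₁ (j (x.update i n)) = 0)
    (hΛ₂ : ∀ (x : RestrictedFamily V x₀) (i : ι), ∀ n ∈ N i, Λ₂ (j (x.update i n)) = 0)
    (hne : ∃ w ∈ stage k j S, Λ₁ w ≠ 0) :
    ∃ c : k, ∀ w ∈ stage k j S, Λ₂ w = c * Λ₁ w := by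
  classical
  set jS := stageMap' (k := k) j S with hjSdef
  have hjS : IsRestrictedMultilinear k jS := isRestrictedMultilinear_stageMap' hj S
  -- the slot images of the `N i` inside the stage
  set M : Submodule k (stage k j S) :=
    ⨆ (m : RestrictedFamily (fun i : S => V i) (fun i : S => x₀ i)) (i : S),
      (N (i : ι)).map (hjS.slot m i) with hM
  have hNM : ∀ (m : RestrictedFamily (fun i : S => V i) (fun i : S => x₀ i)) (i : S),
      N (i : ι) ≤ M.comap (hjS.slot m i) := fun m i =>
    Submodule.map_le_iff_le_comap.1
      (le_iSup₂ (f := fun (m : RestrictedFamily (fun i : S => V i) (fun i : S => x₀ i)) (i : S) =>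
        (N (i : ι)).map (hjS.slot m i)) m i)
  choose e he' using he
  have hrank : Module.rank k (stage k j S ⧸ M) ≤ 1 :=
    rank_quotient_le_one_of_span_range_eq_top hjS (fun i : S => N (i : ι)) M hNM
      (fun i : S => e (i : ι)) (fun i v => he' (i : ι) v) (span_range_stageMap' j S)
  -- both functionals restricted to the stage kill `M`
  have hkill : ∀ {Λ : W →ₗ[k] k}, (∀ (x : RestrictedFamily V x₀) (i : ι), ∀ n ∈ N i, Λ (j (x.update i n)) = 0) →
      M ≤ LinearMap.ker (Λ.comp (stage k j S).subtype) := by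
    intro Λ hΛ
    refine iSup₂_le fun m i => Submodule.map_le_iff_le_comap.2 fun n hn => ?_
    rw [Submodule.mem_comap, LinearMap.mem_ker, LinearMap.comp_apply, hjS.slot_apply]
    change Λ (j (RestrictedFamily.extend S ⇑(m.update i n))) = 0
    rw [RestrictedFamily.coe_update, RestrictedFamily.extend_update]
    exact hΛ _ _ n hn
  set μ₁ : (stage k j S ⧸ M) →ₗ[k] k := M.liftQ (Λ₁.comp (stage k j S).subtype) (hkill hΛ₁) with hμ₁
  set μ₂ : (stage k j S ⧸ M) →ₗ[k] k := M.liftQ (Λ₂.comp (stage k j S).subtype) (hkill hΛ₂) with hμ₂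
  have hμ₁_apply : ∀ w : stage k j S, μ₁ (M.mkQ w) = Λ₁ w := fun w => rfl
  have hμ₂_apply : ∀ w : stage k j S, μ₂ (M.mkQ w) = Λ₂ w := fun w => rfl
  have hμ₁ne : μ₁ ≠ 0 := by
    obtain ⟨w, hw, hw0⟩ := hne
    intro h0
    apply hw0
    rw [← hμ₁_apply ⟨w, hw⟩, h0, LinearMap.zero_apply]
  obtain ⟨c, hc⟩ := dual_eq_smul_of_rank_le_one hrank μ₁ μ₂ hμ₁ne
  refine ⟨c, fun w hw => ?_⟩
  rw [← hμ₂_apply ⟨w, hw⟩, ← hμ₁_apply ⟨w, hw⟩, hc, LinearMap.smul_apply, smul_eq_mul]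

end Stage

/-! ### 3. Exhaustion: uniqueness on the whole restricted tensor product -/

section Main

variable {ι : Type u} [DecidableEq ι] {k : Type*} [Field k] {V : ι → Type v} [∀ i, AddCommGroup (V i)]
  [∀ i, Module k (V i)] {x₀ : ∀ i, V i} {W : Type w} [AddCommGroup W] [Module k W]
  {j : RestrictedFamily V x₀ → W} {S₀ : Finset ι}

/-- **Uniqueness of functionals on a restricted tensor product killing rank-one local kernels**
(the linear algebra of "`dim Hom_N(⊗'_v π_v, ψ) ≤ 1` from `dim Hom_{N_v}(π_v, ψ_v) ≤ 1`", Cogdell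
(2004), §1.2; Bump (1997), Thm. 3.5.2): let `(W, j) = ⊗'_i (V i, x₀ i)` be a restricted tensor
product and `N i ≤ V i` submodules with `V i = k e_i + N i`. If `Λ₁, Λ₂ : W → k` are linear, vanish
on every slot image `j (x.update i n)` (`n ∈ N i`) and `Λ₁ ≠ 0`, then `Λ₂ = c Λ₁`. (Stagewise
proportionality, `exists_forall_mem_stage_eq_mul`; the stages exhaust `W`,
`IsRestrictedTensorProduct.exists_mem_range_liftFinset`, and are directed, so the constant read off at
a vector with `Λ₁ w₀ ≠ 0` serves everywhere.) [cite: CogdellAnalyticTheory2004, §1.2 (proof of Cor. 1.4)] -/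
theorem exists_eq_smul_of_forall_apply_update_eq_zero (h : IsRestrictedTensorProduct k j S₀)
    (N : ∀ i, Submodule k (V i)) (he : ∀ i, ∃ e : V i, ∀ v : V i, ∃ r : k, v - r • e ∈ N i)
    {Λ₁ Λ₂ : W →ₗ[k] k}
    (hΛ₁ : ∀ (x : RestrictedFamily V x₀) (i : ι), ∀ n ∈ N i, Λ₁ (j (x.update i n)) = 0)
    (hΛ₂ : ∀ (x : RestrictedFamily V x₀) (i : ι), ∀ n ∈ N i, Λ₂ (j (x.update i n)) = 0)
    (hne : Λ₁ ≠ 0) : ∃ c : k, Λ₂ = c • Λ₁ := by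
  classical
  have hj := h.isRestrictedMultilinear
  -- a vector where `Λ₁` is non-zero, and a stage containing it
  have hw₀ : ∃ w₀ : W, Λ₁ w₀ ≠ 0 := by
    by_contra hall
    push Not at hall
    exact hne (LinearMap.ext hall)
  obtain ⟨w₀, hw₀⟩ := hw₀
  obtain ⟨S₁, -, hS₁⟩ := h.exists_mem_range_liftFinset ∅ w₀
  refine ⟨Λ₂ w₀ * (Λ₁ w₀)⁻¹, LinearMap.ext fun w => ?_⟩
  -- a stage containing both `w₀` and `w`
  obtain ⟨S₂, hS₁₂, hS₂⟩ := h.exists_mem_range_liftFinset S₁ w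
  have hw₀' : w₀ ∈ stage k j S₂ := by
    rw [stage_eq_range_liftFinset hj]
    exact hj.range_liftFinset_mono hS₁₂ hS₁
  have hw' : w ∈ stage k j S₂ := by
    rw [stage_eq_range_liftFinset hj]
    exact hS₂
  obtain ⟨c, hc⟩ := exists_forall_mem_stage_eq_mul hj N he S₂ hΛ₁ hΛ₂ ⟨w₀, hw₀', hw₀⟩
  have hc₀ : c = Λ₂ w₀ * (Λ₁ w₀)⁻¹ := by
    rw [hc w₀ hw₀', mul_assoc, mul_inv_cancel₀ hw₀, mul_one]
  rw [LinearMap.smul_apply, smul_eq_mul, ← hc₀]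
  exact hc w hw'

end Main

end Literature.NumberTheory.Automorphic
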